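/-
Origin: expansion seat `planner-pub-hodgecm-mc-axioms-1-g14-0`, handover #W42 2026-08-20T15:53:55Z md5 a3a89ef64328 (PKG 5178d3af9f8b → a3a89ef64328; 177 l.; MECHANICAL (iib-R) rewrite v3.1 of the PKG file as it stands (20 token edits; rules R1x1+RX[h₂]x19)) (`HOME/mc/pub-hodgecm-mc-axioms-1-g14/revendor/kit-r55/stage55/HodgeCM/Model/ThetaHolContinuity.lean`, md5 a3a89ef64328, 177 lines);
landed by the gen-22 packager (p-g22) in gate run 55 REPLACES the earlier landed copy of `HodgeCM/Model/ThetaHolContinuity.lean` (seat copy carried the packager Origin header of an earlier run (stripped)).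
-/
/-
Copyright: pub-hodgecm construction cell (theta-3 lineage, gen 4). PKG Model leaf — node «W6b-hol», (ASM) half,
hypothesis (H1) DISCHARGED down to LF-continuity of the pair action.

STATUS: kernel-checked, zero placeholders. CHECK OF RECORD: loose `lake env lean` against the RUN-33 package of record
plus private oleans of rows #1 (`Model/ThetaHolAssembly` 56115101f1fa) and of the EIGHT vendored twins listed under
PREREQUISITES (mechanical `vendor.py` re-heading of the harness-tree files; the seventh, `AdelicThetaArchContinuity`,
is pv07-g10's (W-cont) file fe03f4a6946d, TREE CLAIM 2026-08-19T05:31:42Z).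

PREREQUISITES (packager, RUN 35+): row #1 `Model/ThetaHolAssembly`; vendored twins (NEW, none installed in RUN 33)
`HodgeCM/Vendored/H21/{Analysis/FunctionSpaces/SchwartzComplete, NumberTheory/Automorphic/AdelicPiSchwartzBruhatFourierInversion,
NumberTheory/Automorphic/AdelicSchwartzBruhatTensor, NumberTheory/Automorphic/AdelicSchwartzBruhatLF,
NumberTheory/Automorphic/AdelicTensorStripping, NumberTheory/Weil1964/AdelicThetaTensorRep,
NumberTheory/Weil1964/AdelicThetaArchDerivative, NumberTheory/Weil1964/AdelicThetaArchContinuity}` — the last one only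
after its tree proposal is ACCEPTED (re-cut this leaf if its bytes move in review; only the name and statement of
`continuous_toThetaTop_repWeilThetaDatum_thinCosetTestFunₗ` are used).
-/
import Summits.HodgeConjecture.HodgeCM.Model.ThetaHolAssembly_2
import Literature.NumberTheory.Weil1964.AdelicThetaArchContinuity

/-!
# Node W6b-hol — (H1) from LF-continuity: `hT` is not a hypothesis on an LF-continuous adelic side

Row #1 (`Model/ThetaHolAssembly`) assembles E's binder `hol` from three one-sided hypotheses, the first of which is
(H1) `hT : ((S V c).P k).IsThetaArchContinuous N` — continuity, for every weight function `f` and `y ∈ G_U(𝔸)`, of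
the archimedean theta functional `Φ_∞ ↦ ϑ_f(φ_N(Φ_∞))(y)` on the Schwartz space `𝓢(X_∞)`; § 2 of row #1 reduced it to
(W-cont) `Continuous (P.archSlotT N)`: continuity of the archimedean slot `Φ_∞ ↦ φ_N(Φ_∞) = Φ_∞ ⊗ 1_{x₀ + N𝒪̂^J}`
INTO THE `Θ`-INITIAL CARRIER `P.weilDatum.ThetaTop`.

(W-cont) is now a harness-tree theorem (pv07 gen 10, `Literature/NumberTheory/Weil1964/AdelicThetaArchContinuity`,
Banach–Steinhaus on the barrelled space `𝓢(X_∞)` + Weil's theta majorants, [Weil1964, Chap. III n° 41, Lemme 5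
p. 192, Thm 6 p. 193; Chap. I n° 11 pp. 155–156]): `continuous_toThetaTop_repWeilThetaDatum_thinCosetTestFunₗ` — for a
Weil action `ρ` on `𝒮(𝔸_F^n)` with theta majorants whose operators are LF-continuous (`IsLFContinuous`: finite
continuous expansion on every Fréchet piece `𝓢(X_∞) ⊗ Φ_f`), the thin-coset slot is continuous into `ThetaTop`.

For the pair data `P : WeilPairData K L (Fin n) G_U` of the package, `P.weilDatum` IS `repWeilThetaDatum K (Fin n)
P.ω.toHomUnits (Γ_U × U(W)(L₀))` (`SupplyResidual`), the majorants are the field (W-maj⁺) `P.majorants`, and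
`P.archSlotT N = thinCosetTestFunₗ (ι_f x₀) (N)` definitionally; so:

* `WeilPairData.IsLFAction P := ∀ g, IsLFContinuous (P.ω g)`;
* `WeilPairData.isLFAction_of_eq_adelicTensorEnd` : `(∀ g Φ, P.ω g Φ = adelicTensorEnd ↑(A g) (B g) Φ) → P.IsLFAction` for
  CONTINUOUS archimedean factors `A g : 𝓢(X_∞) →L[ℂ] 𝓢(X_∞)` (producer-side socket: pure-tensor actions are LF-continuous);
* `WeilPairData.continuous_archSlotT_of_isLFContinuous` : `P.IsLFAction → Continuous (P.archSlotT N)`;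
* `WeilPairData.isThetaArchContinuous_of_isLFContinuous` : `… → P.IsThetaArchContinuous N` ((H1) discharged);
* `classPacksOf_pin_of_isPMinusKilled_of_isLFContinuous` : row #1's END-STATE corollary with the binder `hT` REPLACED by
  `hLF : ∀ V c k, ((S V c).P k).IsLFAction` (`∀ g, IsLFContinuous (ω g)`) — a property of the DATA `S` (for the honest adelic side: Weil's
  `r(S)` is LF-continuous operator by operator, tree `isLFContinuous_*` closure lemmas of `AdelicSchwartzBruhatLF` /
  the metaplectic kernel; it is NOT claimed here).

No records, no citations as hypotheses; the one `Prop` definition `IsLFAction` abbreviates `∀ g, IsLFContinuous (P.ω g)`.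
-/

noncomputable section

open scoped Classical SchwartzMap NumberField
open NumberField.mixedEmbedding
open Literature.NumberTheory.Automorphic Literature.NumberTheory.Weil1964
open Literature.AlgebraicGeometry.HodgeTheory
open Literature.AlgebraicGeometry.ShimuraVarieties
open Literature.NumberTheory.Automorphic.PicardCM
open HodgeCM.PerL34.Seesaw HodgeCM.PerL34.RationalCoset HodgeCM.PerL34.SupplyAdelic
open HodgeCM.Model.SupplyInstance HodgeCM.Model.SupplyResidual
open HodgeCM.Model.ThetaSpace

namespace HodgeCM
namespace Model

/-! ## §1. (W-cont) and (H1) for a pair datum with LF-continuous action -/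

namespace SupplyResidual.WeilPairData

variable {K L : Type} [Field K] [NumberField K] [Field L] [NumberField L] [Algebra K L] [FiniteDimensional K L]
variable {GU : Type} [Group GU] [TopologicalSpace GU] {n : ℕ} (P : WeilPairData K L (Fin n) GU)

attribute [local instance] SupplyInstance.ratModule

/-- **LF-continuity of the pair action**: every operator `ω(g)`, `g ∈ G_U(𝔸) × U(W)(𝔸)`, is LF-continuous
(`IsLFContinuous`: a finite expansion `ω(g)(φ ⊗ Φ_f) = Σ_j A_j φ ⊗ Ψ_j` with CONTINUOUS `A_j` on every Fréchet piece).
A property of the DATA `P`, stated by dot-notation so that the instance arguments are those of `P`. -/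
def IsLFAction : Prop := ∀ g : GU × relNormOneIdeles K L, IsLFContinuous (P.ω g)

/-- **(W-cont) from LF-continuity** [Weil1964, Chap. III n° 41, Thm 6 p. 193, via the tree theorem
`continuous_toThetaTop_repWeilThetaDatum_thinCosetTestFunₗ`]: if every operator `ω(g)` of the pair action is
LF-continuous, the archimedean slot `Φ_∞ ↦ φ_N(Φ_∞)` is continuous from `𝓢(X_∞)` into the `Θ`-initial carrier
`P.weilDatum.ThetaTop` (the theta majorants are the field `P.majorants`). -/
theorem continuous_archSlotT_of_isLFContinuous (hLF : P.IsLFAction) (N : ℕ) : Continuous (P.archSlotT N) :=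
  continuous_toThetaTop_repWeilThetaDatum_thinCosetTestFunₗ P.ω.toHomUnits
    ((P.ΓU.prod (relNormOneRat K L) : Subgroup (GU × relNormOneIdeles K L)) : Set (GU × relNormOneIdeles K L))
    P.majorants hLF (finEmb K (Fin n) P.x₀) (Ideal.span {(N : 𝓞 K)})

variable [IsTopologicalGroup GU] [LocallyCompactSpace GU] [CompactSpace (GU ⧸ P.ΓU)]

/-- **(H1) from LF-continuity**: the archimedean theta functionals `Φ_∞ ↦ ϑ_f(φ_N(Φ_∞))(y)` of a pair datum with
LF-continuous action are continuous linear functionals on `𝓢(X_∞)` (row #1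
`isThetaArchContinuous_of_continuous_archSlotT` + (W-cont)). -/
theorem isThetaArchContinuous_of_isLFContinuous (hLF : P.IsLFAction) (N : ℕ) : P.IsThetaArchContinuous N :=
  P.isThetaArchContinuous_of_continuous_archSlotT N (P.continuous_archSlotT_of_isLFContinuous hLF N)

omit [IsTopologicalGroup GU] [LocallyCompactSpace GU] [CompactSpace (GU ⧸ P.ΓU)] in
/-- **LF-continuity of a pure-tensor action** (the producer-side socket for `hLF`): if every operator `ω(g)` AGREES
with a pure tensor `A_g ⊗ B_g` whose archimedean factor `A_g` is a CONTINUOUS operator of `𝓢(X_∞)` — the shape of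
every adelic Weil operator `r(g_∞, g_f) = r_∞(g_∞) ⊗ r_f(g_f)` assembled from a continuous archimedean representation —
then the pair action is LF-continuous (twin `isLFContinuous_adelicTensorEnd` + `IsLFContinuous.congr`). -/
theorem isLFAction_of_eq_adelicTensorEnd
    (A : GU × relNormOneIdeles K L → (𝓢(((Fin n) → mixedSpace K), ℂ) →L[ℂ] 𝓢(((Fin n) → mixedSpace K), ℂ)))
    (B : GU × relNormOneIdeles K L → (FinSB K (Fin n) →ₗ[ℂ] FinSB K (Fin n)))
    (h : ∀ g Φ, P.ω g Φ =
      adelicTensorEnd (A g : 𝓢(((Fin n) → mixedSpace K), ℂ) →ₗ[ℂ] 𝓢(((Fin n) → mixedSpace K), ℂ)) (B g) Φ) :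
    P.IsLFAction :=
  fun g => (isLFContinuous_adelicTensorEnd (A g) (B g)).congr (h g)

end SupplyResidual.WeilPairData

/-! ## §2. The END STATE with (H1) discharged: binders (LF) `hLF`, (AN) `hd`, (REP) `hk` -/

section EndState

variable (hHD : exists_isReal_hodgeModel) (hI : hodgePQ_independent_of_hodgeModel)
  (h₁ : BallQuotientUniformised)  (h₃ : CMAbelianVarietyRealised)

/-- **E's `classPacks` over the END STATE from `S`, `C`, LF-continuity of the pair actions of `S`, (AN) and (REP)**
— row #1's `classPacksOf_pin_of_isPMinusKilled` with its binder (H1) `hT` replaced by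
`hLF : ∀ V c k, ((S V c).P k).IsLFAction` (`WeilPairData.isThetaArchContinuous_of_isLFContinuous`). -/
theorem classPacksOf_pin_of_isPMinusKilled_of_isLFContinuous (h : Bool)
    (emb : ∀ {L : CMField} {ι₁ : L →+* ℂ} {V : HermSpace3 L ι₁} (Γ : Level V),
      (picardCMUniverse hHD hI h₁ h₃).CohC ((picardCMUniverse hHD hI h₁ h₃).pms L ι₁ V Γ) 2 →ₗ[ℂ]
        (V.latticeModel printFact_unitaryCompact_holds).toQuotientModel.H)
    (cover : ∀ {L : CMField} {ι₁ : L →+* ℂ} {V : HermSpace3 L ι₁} (Γ Γ' : Level V),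
      Γ'.Γ ≤ Γ.Γ → (picardCMUniverse hHD hI h₁ h₃).Mor ((picardCMUniverse hHD hI h₁ h₃).pms L ι₁ V Γ')
        ((picardCMUniverse hHD hI h₁ h₃).pms L ι₁ V Γ))
    (wm : ∀ {L : CMField} {ι₁ : L →+* ℂ} (V : HermSpace3 L ι₁) (c : SeesawCtx L),
      WeilThetaModel (V.latticeModel printFact_unitaryCompact_holds).toQuotientModel.G
        (V.latticeModel printFact_unitaryCompact_holds).toQuotientModel.Γ
        (c.D.latticeModelW printFact_unitaryCompact_holds).toQuotientModel.G
        (c.D.latticeModelW printFact_unitaryCompact_holds).toQuotientModel.Γ)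
    (S : ∀ {L : CMField} {ι₁ : L →+* ℂ} (V : HermSpace3 L ι₁) (c : SeesawCtx L), ThetaAdelicSide V c)
    (d12 d34 : ∀ {L : CMField}, SeesawCtx L → HodgeCM.Universe.SideData L)
    (C : ∀ {L : CMField} {ι₁ : L →+* ℂ} (V : HermSpace3 L ι₁) (c : SeesawCtx L) (hV : IsAnisotropic L V.Hm),
      (thetaModelOf hHD hI h₁ h₃ h emb cover wm
        (thetaOf _ (thetaClassInputOf _ (fun V c => thetaSpaceInputOf hHD hI h₁ h₃ S V c))) d12 d34).GoodCtx
          ι₁ c →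
      Module.finrank ℚ c.K = 6 → ∀ k : Fin 4, k = 0 ∨ k = 1 → ∀ N : ℕ, 0 < N →
        ArchKTypeData (thetaSpaceInputIn hHD hI h₁ h₃ (S V c) hV) k N)
    (hLF : ∀ {L : CMField} {ι₁ : L →+* ℂ} (V : HermSpace3 L ι₁) (c : SeesawCtx L) (k : Fin 4), ((S V c).P k).IsLFAction)
    (hd : ∀ {L : CMField} {ι₁ : L →+* ℂ} (V : HermSpace3 L ι₁) (c : SeesawCtx L) (hV : IsAnisotropic L V.Hm)
      (hc : (thetaModelOf hHD hI h₁ h₃ h emb cover wm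
        (thetaOf _ (thetaClassInputOf _ (fun V c => thetaSpaceInputOf hHD hI h₁ h₃ S V c))) d12 d34).GoodCtx
          ι₁ c)
      (h6 : Module.finrank ℚ c.K = 6) (k : Fin 4) (hk : k = 0 ∨ k = 1) (N : ℕ) (hN : 0 < N),
      (C V c hV hc h6 k hk N hN).IsWeaklyPDiff BallForms.expP)
    (hk : ∀ {L : CMField} {ι₁ : L →+* ℂ} (V : HermSpace3 L ι₁) (c : SeesawCtx L) (hV : IsAnisotropic L V.Hm)
      (hc : (thetaModelOf hHD hI h₁ h₃ h emb cover wm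
        (thetaOf _ (thetaClassInputOf _ (fun V c => thetaSpaceInputOf hHD hI h₁ h₃ S V c))) d12 d34).GoodCtx
          ι₁ c)
      (h6 : Module.finrank ℚ c.K = 6) (k : Fin 4) (hk : k = 0 ∨ k = 1) (N : ℕ) (hN : 0 < N),
      (C V c hV hc h6 k hk N hN).IsPMinusKilled BallForms.expP)
    {L : CMField} {ι₁ : L →+* ℂ} (V : HermSpace3 L ι₁) (c : SeesawCtx L)
    (hc : (thetaModelOf hHD hI h₁ h₃ h emb cover wm
      (thetaOf _ (thetaClassInputOf _ (fun V c => thetaSpaceInputOf hHD hI h₁ h₃ S V c))) d12 d34).GoodCtx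
        ι₁ c)
    (h6 : Module.finrank ℚ c.K = 6) :
    Nonempty (ClassSupplyPackN (thetaModelOf hHD hI h₁ h₃ h emb cover wm
        (thetaOf _ (thetaClassInputOf _ (fun V c => thetaSpaceInputOf hHD hI h₁ h₃ S V c))) d12 d34) V c 0) ∧
      Nonempty (ClassSupplyPackN (thetaModelOf hHD hI h₁ h₃ h emb cover wm
        (thetaOf _ (thetaClassInputOf _ (fun V c => thetaSpaceInputOf hHD hI h₁ h₃ S V c))) d12 d34) V c 1) :=
  classPacksOf_pin_of_isPMinusKilled hHD hI h₁ h₃ h emb cover wm S d12 d34 C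
    (fun V c k N => ((S V c).P k).isThetaArchContinuous_of_isLFContinuous (hLF V c k) N) hd hk V c hc h6

end EndState

end Model
end HodgeCM

end
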